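import Mathlib
import HarnessLib
import Summits.ResolutionOfSingularities.ResolutionOfSingularities.Theorems.WildQuotientsWildQuotientResolutionConductorOneChartAlgebra

/-!
# S2 brick F2′ — the chart algebra of the conductor-𝟙 core in STRAIGHTENED coordinates `(s, c_K, e_J)`

(crux stmt-ResolutionOfSingularities-15640 `WildQuotients.WildQuotientResolution`, line `Sketch`;
post-V5 rung S2 = `ConductorOneCore p n` — res-L1-w45c-lead-1 g5 `L/res-L1-w45c-lead-1/S2-DESIGN.md`
AMENDMENT v1.1 §7 (cf86329d6176a7c9; (7.1) diagonal-Möbius action, (7.2) ψ₀-monomials, (7.4) monic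
identities) and res-L1-w45c-plan-1 RULING 2026-08-27T17:07:17Z (R1)/(R3) «F2′ = ONE sequel to F2
p549957 in (s,c,e) letters». [OURS · L1 W4.5c] — NOT a statement of any manuscript; replaces the role of
no printed item. LAW-BASED and def-free: any commutative ring `M` with an endomorphism `σ` and elements
`s`, `c_k`, `e_j` subject to the DIAGONAL-MÖBIUS laws
  `σ s · (1 + s) = s`,  `σ c_k · (1 + s) = c_k`,  `σ e_j = e_j · (1 + s)`;
inverses enter as explicit witnesses (`(1 + s) w₁ = 1`, `u v = 1` with `u := 1 − s^{p−1}`, …); characteristic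
`p` only where stated. The (s,t)-file F2 (`…ConductorOneChartAlgebra`, imported) supplies the degree
calculus (`mul_deg`, `prod_deg`, `pow_deg`, `prod_negdeg`, `pow_negdeg`, `pow_s_deg`, `one_sub_pow_deg`,
`monic_s`). Prover res-L1-w45c-stub-3.)

CONTENTS. (a) `v_negdeg` — `σ v = v (1+s)^p` for the inverse witness `v` of `u` (with F2's
`one_sub_pow_deg : σ u · (1+s)^p = u`). (b) **ψ₀-monomial invariance** (7.2), both signs of the cone
degree `d`: `psi0_invariant_pos` — `s^{m_i} c^α e^β v^d` is `σ`-invariant when `m_i + |α| = p d + |β|`;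
`psi0_invariant_neg` — `s^{m_i} c^α e^β u^d` is invariant when `m_i + |α| + p d = |β|`; named instances
`Tw_invariant'` (`s^{p−1} c_k v = T w_k`), `Twp_invariant'` (`c_k^p v = T w_k^p`), `b_invariant'` (`s e_j = b_j`),
`bpow_invariant'`, `bpT_invariant'` (`e_j^p u = b_j^p/T`); `T = s^p v` is F2's `T_invariant`. (c) the **monic
identities** (7.4) as ring identities: `monic_c`, `monic_e` (any characteristic), `monic_y` (`y = v = 1/u`:
`y^p − T^{p−1} y − 1 = 0`, char `p`), and the units `ν` in CLOSED FORM (char `p`):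
`nu_K_eq : ν_k · u = (1 + c_k)((1 + c_k)^{p−1} − s^{p−1})`, `nu_J_eq : ν_j = (1 + e_j)((1 + e_j)^{p−1} − (s e_j)^{p−1})`
— i.e. `ν_k u` and `ν_j` ARE the `h_M`-factors of (7.1), whence the unit witnesses `nu_K_witness`,
`nu_J_witness` and invariance `nu_K_invariant'`, `nu_J_invariant'`. (d) **iterates, unit-free**:
`iterate_law_s/_c/_e` (`σ^m s · (1 + m s) = s`, `σ^m c_k · (1 + m s) = c_k`, `σ^m e_j = e_j (1 + m s)`) and in
characteristic `p`: `iterate_p_s/_c/_e` (`σ^p` fixes the generators) — `σ̃^p = 1` and uniqueness on the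
concrete chart ring then follow by extension from generators (consumer's letters).
-/

-- single-problem summit: the doubled namespace component `ResolutionOfSingularities` is forced
set_option linter.dupNamespace false

noncomputable section

namespace Summit.ResolutionOfSingularities.ResolutionOfSingularities.Theorems.WildQuotientResolution.ConductorOne

variable {M : Type} [CommRing M] (σ : M →+* M) (s : M) (hs : σ s * (1 + s) = s)

/-! ## Two-sided cancellation and the inverse witness of `u = 1 − s^{p−1}` -/

/-- Negative degrees add: `σ x = x (1+s)^a`, `σ y = y (1+s)^b` ⇒ `σ (xy) = xy (1+s)^{a+b}`. [folklore] -/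
theorem mul_negdeg {x y : M} {a b : ℕ} (hx : σ x = x * (1 + s) ^ a) (hy : σ y = y * (1 + s) ^ b) :
    σ (x * y) = x * y * (1 + s) ^ (a + b) := by
  rw [map_mul, hx, hy, pow_add]; ring

/-- **Cancellation**: a product of a degree-`A` element and a degree-`−A` element is invariant
(`1 + s` a unit, witness `w₁`). [folklore] -/
theorem invariant_of_deg_eq (w₁ : M) (hw₁ : (1 + s) * w₁ = 1) {x y : M} {A : ℕ}
    (hx : σ x * (1 + s) ^ A = x) (hy : σ y = y * (1 + s) ^ A) : σ (x * y) = x * y := by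
  have hu : IsUnit ((1 + s) ^ A) := (IsUnit.of_mul_eq_one _ hw₁).pow A
  apply hu.mul_left_injective
  change σ (x * y) * (1 + s) ^ A = x * y * (1 + s) ^ A
  rw [map_mul, hy]
  calc σ x * (y * (1 + s) ^ A) * (1 + s) ^ A = (σ x * (1 + s) ^ A) * (y * (1 + s) ^ A) := by ring
    _ = x * y * (1 + s) ^ A := by rw [hx]; ring

include hs in
/-- The inverse witness `v` of `u = 1 − s^{p−1}` has degree `−p`: `σ v = v (1+s)^p` (characteristic `p`).
[OURS · L1 W4.5c] -/
theorem v_negdeg (p : ℕ) [Fact p.Prime] [CharP M p] (v : M) (hv : (1 - s ^ (p - 1)) * v = 1) :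
    σ v = v * (1 + s) ^ p := by
  have hdeg := one_sub_pow_deg σ s hs p
  have h1 : σ (1 - s ^ (p - 1)) * σ v = 1 := by rw [← map_mul, hv, map_one]
  calc σ v = σ v * ((1 - s ^ (p - 1)) * v) := by rw [hv, mul_one]
    _ = σ v * (σ (1 - s ^ (p - 1)) * (1 + s) ^ p) * v := by rw [hdeg]; ring
    _ = (σ (1 - s ^ (p - 1)) * σ v) * v * (1 + s) ^ p := by ring
    _ = v * (1 + s) ^ p := by rw [h1, one_mul]

/-! ## ψ₀-monomial invariance (S2-DESIGN (7.2)) -/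

variable {κ : Type} (c : κ → M) (hc : ∀ k, σ (c k) * (1 + s) = c k)
  {ι : Type} (e : ι → M) (he : ∀ j, σ (e j) = e j * (1 + s))

include hs hc in
/-- `deg (s^{m_i} ∏_{k∈K} c_k^{α_k}) = m_i + |α|`. [folklore] -/
theorem sc_deg (K : Finset κ) (mi : ℕ) (α : κ → ℕ) :
    σ (s ^ mi * ∏ k ∈ K, c k ^ α k) * (1 + s) ^ (mi + ∑ k ∈ K, α k) = s ^ mi * ∏ k ∈ K, c k ^ α k := by
  have hprod := prod_deg σ s K (fun k => c k ^ α k) (fun k => α k * 1)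
    fun k _ => pow_deg σ s (a := 1) (by rw [pow_one]; exact hc k) (α k)
  simp only [mul_one] at hprod
  exact mul_deg σ s (pow_s_deg σ s hs mi) hprod

include he in
/-- `deg (∏_{j∈J} e_j^{β_j}) = −|β|`. [folklore] -/
theorem e_negdeg (J : Finset ι) (β : ι → ℕ) :
    σ (∏ j ∈ J, e j ^ β j) = (∏ j ∈ J, e j ^ β j) * (1 + s) ^ (∑ j ∈ J, β j) := by
  have hprod := prod_negdeg σ s J (fun j => e j ^ β j) (fun j => β j * 1)
    fun j _ => pow_negdeg σ s (a := 1) (by rw [pow_one]; exact he j) (β j)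
  simp only [mul_one] at hprod
  exact hprod

include hs hc he in
/-- **ψ₀-monomial invariance, `d ≥ 0`**: `σ (s^{m_i} c^α e^β v^d) = s^{m_i} c^α e^β v^d` whenever
`m_i + |α| = p·d + |β|` (`u v = 1`, `(1+s) w₁ = 1`; S2-DESIGN (7.2) «invariance in one line»).
[OURS · L1 W4.5c] -/
theorem psi0_invariant_pos (p : ℕ) [Fact p.Prime] [CharP M p] (w₁ : M) (hw₁ : (1 + s) * w₁ = 1)
    (v : M) (hv : (1 - s ^ (p - 1)) * v = 1) (K : Finset κ) (J : Finset ι) (mi : ℕ) (α : κ → ℕ)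
    (β : ι → ℕ) (d : ℕ) (hdeg : mi + ∑ k ∈ K, α k = p * d + ∑ j ∈ J, β j) :
    σ (s ^ mi * (∏ k ∈ K, c k ^ α k) * (∏ j ∈ J, e j ^ β j) * v ^ d)
      = s ^ mi * (∏ k ∈ K, c k ^ α k) * (∏ j ∈ J, e j ^ β j) * v ^ d := by
  have hx := sc_deg σ s hs c hc K mi α
  have hy : σ ((∏ j ∈ J, e j ^ β j) * v ^ d)
      = (∏ j ∈ J, e j ^ β j) * v ^ d * (1 + s) ^ (∑ j ∈ J, β j + d * p) :=
    mul_negdeg σ s (e_negdeg σ s e he J β) (pow_negdeg σ s (v_negdeg σ s hs p v hv) d)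
  rw [show ∑ j ∈ J, β j + d * p = mi + ∑ k ∈ K, α k by rw [hdeg]; ring] at hy
  have := invariant_of_deg_eq σ s w₁ hw₁ hx hy
  calc σ (s ^ mi * (∏ k ∈ K, c k ^ α k) * (∏ j ∈ J, e j ^ β j) * v ^ d)
      = σ (s ^ mi * (∏ k ∈ K, c k ^ α k) * ((∏ j ∈ J, e j ^ β j) * v ^ d)) := by ring_nf
    _ = s ^ mi * (∏ k ∈ K, c k ^ α k) * ((∏ j ∈ J, e j ^ β j) * v ^ d) := this
    _ = _ := by ring

include hs hc he in
/-- **ψ₀-monomial invariance, `d ≤ 0`**: `σ (s^{m_i} c^α e^β u^d) = s^{m_i} c^α e^β u^d` whenever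
`m_i + |α| + p·d = |β|` (`u = 1 − s^{p−1}`). [OURS · L1 W4.5c] -/
theorem psi0_invariant_neg (p : ℕ) [Fact p.Prime] [CharP M p] (w₁ : M) (hw₁ : (1 + s) * w₁ = 1)
    (K : Finset κ) (J : Finset ι) (mi : ℕ) (α : κ → ℕ) (β : ι → ℕ) (d : ℕ)
    (hdeg : mi + ∑ k ∈ K, α k + p * d = ∑ j ∈ J, β j) :
    σ (s ^ mi * (∏ k ∈ K, c k ^ α k) * (∏ j ∈ J, e j ^ β j) * (1 - s ^ (p - 1)) ^ d)
      = s ^ mi * (∏ k ∈ K, c k ^ α k) * (∏ j ∈ J, e j ^ β j) * (1 - s ^ (p - 1)) ^ d := by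
  have hx : σ (s ^ mi * (∏ k ∈ K, c k ^ α k) * (1 - s ^ (p - 1)) ^ d)
      * (1 + s) ^ (mi + ∑ k ∈ K, α k + d * p) = s ^ mi * (∏ k ∈ K, c k ^ α k) * (1 - s ^ (p - 1)) ^ d :=
    mul_deg σ s (sc_deg σ s hs c hc K mi α) (pow_deg σ s (one_sub_pow_deg σ s hs p) d)
  have hy := e_negdeg σ s e he J β
  rw [show mi + ∑ k ∈ K, α k + d * p = ∑ j ∈ J, β j by rw [← hdeg]; ring] at hx
  have := invariant_of_deg_eq σ s w₁ hw₁ hx hy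
  calc σ (s ^ mi * (∏ k ∈ K, c k ^ α k) * (∏ j ∈ J, e j ^ β j) * (1 - s ^ (p - 1)) ^ d)
      = σ (s ^ mi * (∏ k ∈ K, c k ^ α k) * (1 - s ^ (p - 1)) ^ d * (∏ j ∈ J, e j ^ β j)) := by ring_nf
    _ = s ^ mi * (∏ k ∈ K, c k ^ α k) * (1 - s ^ (p - 1)) ^ d * (∏ j ∈ J, e j ^ β j) := this
    _ = _ := by ring

include hs hc in
/-- `T w_k = s^{p−1} c_k v` is invariant. [OURS · L1 W4.5c] -/
theorem Tw_invariant' (p : ℕ) [hp : Fact p.Prime] [CharP M p] (w₁ : M) (hw₁ : (1 + s) * w₁ = 1)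
    (v : M) (hv : (1 - s ^ (p - 1)) * v = 1) (k : κ) :
    σ (s ^ (p - 1) * c k * v) = s ^ (p - 1) * c k * v := by
  have hx : σ (s ^ (p - 1) * c k) * (1 + s) ^ ((p - 1) + 1) = s ^ (p - 1) * c k :=
    mul_deg σ s (pow_s_deg σ s hs (p - 1)) (by rw [pow_one]; exact hc k)
  rw [Nat.sub_add_cancel hp.out.one_le] at hx
  have hy := v_negdeg σ s hs p v hv
  exact invariant_of_deg_eq σ s w₁ hw₁ hx hy

include hs hc in
/-- `T w_k^p = c_k^p v` is invariant. [OURS · L1 W4.5c] -/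
theorem Twp_invariant' (p : ℕ) [Fact p.Prime] [CharP M p] (w₁ : M) (hw₁ : (1 + s) * w₁ = 1)
    (v : M) (hv : (1 - s ^ (p - 1)) * v = 1) (k : κ) : σ (c k ^ p * v) = c k ^ p * v := by
  have hx : σ (c k ^ p) * (1 + s) ^ (p * 1) = c k ^ p :=
    pow_deg σ s (a := 1) (by rw [pow_one]; exact hc k) p
  rw [mul_one] at hx
  exact invariant_of_deg_eq σ s w₁ hw₁ hx (v_negdeg σ s hs p v hv)

include hs he in
/-- `b_j = s e_j` is invariant. [OURS · L1 W4.5c] -/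
theorem b_invariant' (j : ι) : σ (s * e j) = s * e j := by
  rw [map_mul, he j]
  calc σ s * (e j * (1 + s)) = σ s * (1 + s) * e j := by ring
    _ = s * e j := by rw [hs]

include hs he in
/-- `b_j^m = (s e_j)^m` is invariant. [folklore] -/
theorem bpow_invariant' (j : ι) (m : ℕ) : σ ((s * e j) ^ m) = (s * e j) ^ m := by
  rw [map_pow, b_invariant' σ s hs e he j]

include hs he in
/-- `b_j^p/T = e_j^p u` is invariant (`u = 1 − s^{p−1}`). [OURS · L1 W4.5c] -/
theorem bpT_invariant' (p : ℕ) [Fact p.Prime] [CharP M p] (j : ι) :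
    σ (e j ^ p * (1 - s ^ (p - 1))) = e j ^ p * (1 - s ^ (p - 1)) := by
  apply invariant_of_negdeg_p σ s hs p
  have := pow_negdeg σ s (a := 1) (by rw [pow_one]; exact he j) p
  rwa [mul_one] at this

/-! ## The monic identities (S2-DESIGN (7.4)) and the units `ν_k`, `ν_j` -/

/-- **(7.4), `c_k`**: `X^p + T w_k X^{p−1} − T w_k^p` vanishes at `X = c_k`
(`T w_k = s^{p−1} c_k v`, `T w_k^p = c_k^p v`, `u v = 1`; any characteristic). [OURS · L1 W4.5c] -/
theorem monic_c (p : ℕ) [hp : Fact p.Prime] (v : M) (hv : (1 - s ^ (p - 1)) * v = 1) (k : κ) :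
    c k ^ p + s ^ (p - 1) * c k * v * c k ^ (p - 1) - c k ^ p * v = 0 := by
  have e3 : c k * c k ^ (p - 1) = c k ^ p := mul_pow_sub_one hp.out.ne_zero _
  linear_combination (s ^ (p - 1) * v) * e3 - (c k ^ p) * hv

/-- **(7.4), `e_j`**: `X^p − b_j^{p−1} X − b_j^p/T` vanishes at `X = e_j`
(`b_j = s e_j`, `b_j^p/T = e_j^p u`; any characteristic). [OURS · L1 W4.5c] -/
theorem monic_e (p : ℕ) [hp : Fact p.Prime] (j : ι) :
    e j ^ p - (s * e j) ^ (p - 1) * e j - e j ^ p * (1 - s ^ (p - 1)) = 0 := by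
  have e3 : e j ^ (p - 1) * e j = e j ^ p := pow_sub_one_mul hp.out.ne_zero _
  rw [mul_pow]
  linear_combination (-(s ^ (p - 1))) * e3

/-- **(7.4), `y = 1/u`**: `y^p − T^{p−1} y − 1 = 0` for the inverse witness `v` of `u = 1 − s^{p−1}`
and `T = s^p v` (characteristic `p`: `u^p = 1 − s^{p(p−1)}`). [OURS · L1 W4.5c] -/
theorem monic_y (p : ℕ) [hp : Fact p.Prime] [CharP M p] (v : M) (hv : (1 - s ^ (p - 1)) * v = 1) :
    v ^ p - (s ^ p * v) ^ (p - 1) * v - 1 = 0 := by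
  have hp0 : p ≠ 0 := hp.out.ne_zero
  have h1 : ((1 - s ^ (p - 1)) * v) ^ p = 1 := by rw [hv, one_pow]
  rw [mul_pow, sub_pow_char, one_pow, ← pow_mul] at h1
  have e3 : v ^ (p - 1) * v = v ^ p := pow_sub_one_mul hp0 _
  rw [mul_pow, ← pow_mul, mul_comm p (p - 1)]
  linear_combination h1 - (s ^ ((p - 1) * p)) * e3

/-- **`ν_k` in closed form** (characteristic `p`): `ν_k := 1 − T w_k + T w_k^p` satisfies
`ν_k · u = (1 + c_k)((1 + c_k)^{p−1} − s^{p−1})` — the two `h_M`-factors of (7.1) belonging to `k`.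
[OURS · L1 W4.5c] -/
theorem nu_K_eq (p : ℕ) [hp : Fact p.Prime] [CharP M p] (v : M) (hv : (1 - s ^ (p - 1)) * v = 1)
    (k : κ) :
    (1 - s ^ (p - 1) * c k * v + c k ^ p * v) * (1 - s ^ (p - 1))
      = (1 + c k) * ((1 + c k) ^ (p - 1) - s ^ (p - 1)) := by
  have hfrob : (1 + c k) ^ p = 1 + c k ^ p := by rw [add_pow_char, one_pow]
  have e4 : (1 + c k) ^ (p - 1) * (1 + c k) = (1 + c k) ^ p := pow_sub_one_mul hp.out.ne_zero _
  linear_combination (c k ^ p - s ^ (p - 1) * c k) * hv - e4 - hfrob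

/-- **`ν_j` in closed form** (characteristic `p`): `ν_j := 1 − b_j^{p−1} + b_j^p/T` equals
`(1 + e_j)((1 + e_j)^{p−1} − (s e_j)^{p−1})` — the two `h_M`-factors of (7.1) belonging to `j`.
[OURS · L1 W4.5c] -/
theorem nu_J_eq (p : ℕ) [hp : Fact p.Prime] [CharP M p] (j : ι) :
    1 - (s * e j) ^ (p - 1) + e j ^ p * (1 - s ^ (p - 1))
      = (1 + e j) * ((1 + e j) ^ (p - 1) - (s * e j) ^ (p - 1)) := by
  have hfrob : (1 + e j) ^ p = 1 + e j ^ p := by rw [add_pow_char, one_pow]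
  have e4 : (1 + e j) ^ (p - 1) * (1 + e j) = (1 + e j) ^ p := pow_sub_one_mul hp.out.ne_zero _
  have e3 : e j ^ (p - 1) * e j = e j ^ p := pow_sub_one_mul hp.out.ne_zero _
  rw [mul_pow]
  linear_combination (s ^ (p - 1)) * e3 - e4 - hfrob

/-- **`ν_k` is a unit ⇒ witness**: with inverse witnesses `ck'` of `1 + c_k` and `dk'` of
`(1 + c_k)^{p−1} − s^{p−1}`, `ν_k · (u · ck' · dk') = 1`. [OURS · L1 W4.5c] -/
theorem nu_K_witness (p : ℕ) [Fact p.Prime] [CharP M p] (v : M) (hv : (1 - s ^ (p - 1)) * v = 1)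
    (k : κ) (ck' : M) (hck : (1 + c k) * ck' = 1) (dk' : M)
    (hdk : ((1 + c k) ^ (p - 1) - s ^ (p - 1)) * dk' = 1) :
    (1 - s ^ (p - 1) * c k * v + c k ^ p * v) * ((1 - s ^ (p - 1)) * ck' * dk') = 1 := by
  have h := nu_K_eq s c p v hv k
  calc (1 - s ^ (p - 1) * c k * v + c k ^ p * v) * ((1 - s ^ (p - 1)) * ck' * dk')
      = (1 - s ^ (p - 1) * c k * v + c k ^ p * v) * (1 - s ^ (p - 1)) * ck' * dk' := by ring
    _ = ((1 + c k) * ck') * (((1 + c k) ^ (p - 1) - s ^ (p - 1)) * dk') := by rw [h]; ring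
    _ = 1 := by rw [hck, hdk, one_mul]

/-- **`ν_j` is a unit ⇒ witness**: with inverse witnesses `ej'` of `1 + e_j` and `dj'` of
`(1 + e_j)^{p−1} − (s e_j)^{p−1}`, `ν_j · (ej' · dj') = 1`. [OURS · L1 W4.5c] -/
theorem nu_J_witness (p : ℕ) [Fact p.Prime] [CharP M p] (j : ι) (ej' : M) (hej : (1 + e j) * ej' = 1)
    (dj' : M) (hdj : ((1 + e j) ^ (p - 1) - (s * e j) ^ (p - 1)) * dj' = 1) :
    (1 - (s * e j) ^ (p - 1) + e j ^ p * (1 - s ^ (p - 1))) * (ej' * dj') = 1 := by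
  rw [nu_J_eq s e p j]
  calc (1 + e j) * ((1 + e j) ^ (p - 1) - (s * e j) ^ (p - 1)) * (ej' * dj')
      = ((1 + e j) * ej') * (((1 + e j) ^ (p - 1) - (s * e j) ^ (p - 1)) * dj') := by ring
    _ = 1 := by rw [hej, hdj, one_mul]

include hs hc in
/-- `ν_k` is `σ`-invariant. [OURS · L1 W4.5c] -/
theorem nu_K_invariant' (p : ℕ) [Fact p.Prime] [CharP M p] (w₁ : M) (hw₁ : (1 + s) * w₁ = 1)
    (v : M) (hv : (1 - s ^ (p - 1)) * v = 1) (k : κ) :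
    σ (1 - s ^ (p - 1) * c k * v + c k ^ p * v) = 1 - s ^ (p - 1) * c k * v + c k ^ p * v := by
  rw [map_add, map_sub, map_one, Tw_invariant' σ s hs c hc p w₁ hw₁ v hv k,
    Twp_invariant' σ s hs c hc p w₁ hw₁ v hv k]

include hs he in
/-- `ν_j` is `σ`-invariant. [OURS · L1 W4.5c] -/
theorem nu_J_invariant' (p : ℕ) [Fact p.Prime] [CharP M p] (j : ι) :
    σ (1 - (s * e j) ^ (p - 1) + e j ^ p * (1 - s ^ (p - 1)))
      = 1 - (s * e j) ^ (p - 1) + e j ^ p * (1 - s ^ (p - 1)) := by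
  rw [map_add, map_sub, map_one, bpow_invariant' σ s hs e he j, bpT_invariant' σ s hs e he p j]

/-! ## Iterates of the laws (unit-free) and `σ^p = id` on the generators -/

include hs in
/-- **`σ^m s · (1 + m s) = s`** for all `m` (no units needed). [OURS · L1 W4.5c] -/
theorem iterate_law_s (m : ℕ) : σ^[m] s * (1 + (m : M) * s) = s := by
  induction m with
  | zero => simp
  | succ m ih =>
    have h1 : σ^[m + 1] s * (1 + (m : M) * σ s) = σ s := by
      have := congrArg σ ih
      rwa [map_mul, map_add, map_one, map_mul, map_natCast, ← Function.iterate_succ_apply' σ m s]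
        at this
    push_cast
    linear_combination (1 + s) * h1 + (1 - (m : M) * σ^[m + 1] s) * hs

include hs hc in
/-- **`σ^m c_k · (1 + m s) = c_k`** for all `m`. [OURS · L1 W4.5c] -/
theorem iterate_law_c (k : κ) (m : ℕ) : σ^[m] (c k) * (1 + (m : M) * s) = c k := by
  induction m with
  | zero => simp
  | succ m ih =>
    have h1 : σ^[m + 1] (c k) * (1 + (m : M) * σ s) = σ (c k) := by
      have := congrArg σ ih
      rwa [map_mul, map_add, map_one, map_mul, map_natCast,
        ← Function.iterate_succ_apply' σ m (c k)] at this
    push_cast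
    linear_combination (1 + s) * h1 - ((m : M) * σ^[m + 1] (c k)) * hs + hc k

include hs he in
/-- **`σ^m e_j = e_j (1 + m s)`** for all `m`. [OURS · L1 W4.5c] -/
theorem iterate_law_e (j : ι) (m : ℕ) : σ^[m] (e j) = e j * (1 + (m : M) * s) := by
  induction m with
  | zero => simp
  | succ m ih =>
    have h1 : σ^[m + 1] (e j) = σ (e j) * (1 + (m : M) * σ s) := by
      have := congrArg σ ih
      rwa [map_mul, map_add, map_one, map_mul, map_natCast,
        ← Function.iterate_succ_apply' σ m (e j)] at this
    push_cast
    linear_combination h1 + (1 + (m : M) * σ s) * he j + ((m : M) * e j) * hs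

include hs in
/-- In characteristic `p`: `σ^p s = s`. [OURS · L1 W4.5c] -/
theorem iterate_p_s (p : ℕ) [Fact p.Prime] [CharP M p] : σ^[p] s = s := by
  have h := iterate_law_s σ s hs p
  rwa [CharP.cast_eq_zero, zero_mul, add_zero, mul_one] at h

include hs hc in
/-- In characteristic `p`: `σ^p c_k = c_k`. [OURS · L1 W4.5c] -/
theorem iterate_p_c (p : ℕ) [Fact p.Prime] [CharP M p] (k : κ) : σ^[p] (c k) = c k := by
  have h := iterate_law_c σ s hs c hc k p
  rwa [CharP.cast_eq_zero, zero_mul, add_zero, mul_one] at h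

include hs he in
/-- In characteristic `p`: `σ^p e_j = e_j`. [OURS · L1 W4.5c] -/
theorem iterate_p_e (p : ℕ) [Fact p.Prime] [CharP M p] (j : ι) : σ^[p] (e j) = e j := by
  have h := iterate_law_e σ s hs e he j p
  rwa [CharP.cast_eq_zero, zero_mul, add_zero, mul_one] at h

end Summit.ResolutionOfSingularities.ResolutionOfSingularities.Theorems.WildQuotientResolution.ConductorOne

end
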